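import Mathlib
import Literature.AlgebraicGeometry.Resolution.SmoothStandardSmoothRetract
import Literature.Barriers.Schanuel.NesterenkoModularScopeQuotientDerivation

/-!
# `PAlteration.PicoverToRadicialBottom`: extending a derivation of the constants to `k[X]/(s)`

Route `ResolutionOfSingularities/pAlteration`, crux `PicoverToRadicialBottom`
(stmt-ResolutionOfSingularities-0556), line `theta-finite-cofinite-roots`. Helper file
(`--supports`): the stub `stub_derivationQuotientMvPolynomial`.

For a commutative ring `k`, a finite set `s` of polynomials in `P := k[X₁, …, Xₙ]` and a
derivation `D` of `k` killing every coefficient of every member of `s`, there is a derivation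
`D'` of `A := P/(s)` compatible with `D` along `k → A`. Proof: the coefficientwise extension
`D̃ (Σ c_m X^m) := Σ D(c_m) X^m` of `D` to `P` (`coeffwiseDerivation`,
`Literature/AlgebraicGeometry/Resolution/SmoothStandardSmoothRetract.lean`) kills `s`, hence
stabilises the ideal `(s)` (Leibniz), hence descends to `P/(s)`
(`Literature.Barriers.Schanuel.exists_derivation_quotient`); on constants `D̃ (C a) = C (D a)`.

This is the algebraic heart of the base change of a regular finitely generated `k`-algebra
along `pʳ`-th roots of constants `u` with `D u = 1` (Stacks 07PG downstream).
-/

noncomputable section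

-- single-problem summit: the doubled namespace component `ResolutionOfSingularities` is forced
set_option linter.dupNamespace false

open MvPolynomial
open Literature.AlgebraicGeometry.Resolution Literature.Barriers.Schanuel

namespace Summit.ResolutionOfSingularities.ResolutionOfSingularities.Theorems

/-- The coefficients of the coefficientwise extension `D̃` of a derivation `D` to a polynomial
ring: `coeff m (D̃ f) = D (coeff m f)`. [folklore] -/
theorem coeff_coeffwiseDerivation {k : Type*} [CommRing k] {ι : Type*} (D : Derivation ℤ k k)
    (f : MvPolynomial ι k) (m : ι →₀ ℕ) :
    coeff m (coeffwiseDerivation (ι := ι) D f) = D (coeff m f) :=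
  coeff_coeffMapₗ _ f m

/-- If a derivation `D` of `k` kills every coefficient of every polynomial in `s`, then its
coefficientwise extension `D̃` kills `s` and hence stabilises the ideal `(s)`:
`D̃ (Σ gᵢ fᵢ) = Σ (fᵢ D̃ gᵢ + gᵢ D̃ fᵢ) = Σ fᵢ D̃ gᵢ ∈ (s)`. [folklore] -/
theorem coeffwiseDerivation_mem_span {k : Type*} [CommRing k] {ι : Type*} (D : Derivation ℤ k k)
    (s : Set (MvPolynomial ι k)) (hs : ∀ f ∈ s, ∀ m, D (coeff m f) = 0) :
    ∀ g ∈ Ideal.span s, coeffwiseDerivation (ι := ι) D g ∈ Ideal.span s := by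
  intro g hg
  refine Submodule.span_induction ?_ ?_ ?_ ?_ hg
  · intro f hf
    have h0 : coeffwiseDerivation (ι := ι) D f = 0 :=
      MvPolynomial.ext _ _ fun m => by rw [coeff_coeffwiseDerivation, hs f hf m, coeff_zero]
    rw [h0]
    exact Submodule.zero_mem _
  · rw [map_zero]
    exact Submodule.zero_mem _
  · intro a b _ _ ha hb
    rw [map_add]
    exact add_mem ha hb
  · intro a b hb hDb
    rw [smul_eq_mul, Derivation.leibniz, smul_eq_mul, smul_eq_mul]
    exact add_mem (Ideal.mul_mem_left _ a hDb) (Ideal.mul_mem_right _ _ hb)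

/-- **Extending a derivation of the constants to a quotient of a polynomial ring.** For a
derivation `D` of `k` killing all coefficients of the relations `s ⊆ k[X₁, …, Xₙ]`, there is a
derivation `D'` of `k[X₁, …, Xₙ]/(s)` with `D' ∘ (k → k[X]/(s)) = (k → k[X]/(s)) ∘ D`: the
coefficientwise extension of `D` stabilises `(s)` and descends to the quotient. [folklore] -/
theorem stub_derivationQuotientMvPolynomial :
    ∀ (k : Type) [CommRing k] (n : ℕ) (s : Finset (MvPolynomial (Fin n) k)) (D : Derivation ℤ k k),
      (∀ f ∈ s, ∀ m, D (MvPolynomial.coeff m f) = 0) →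
      ∃ D' : Derivation ℤ (MvPolynomial (Fin n) k ⧸ Ideal.span (s : Set (MvPolynomial (Fin n) k)))
          (MvPolynomial (Fin n) k ⧸ Ideal.span (s : Set (MvPolynomial (Fin n) k))),
        ∀ a : k, D' (algebraMap k _ a) = algebraMap k _ (D a) := by
  intro k _ n s D hs
  obtain ⟨D', hD'⟩ := exists_derivation_quotient (coeffwiseDerivation (ι := Fin n) D)
    (Ideal.span (s : Set (MvPolynomial (Fin n) k)))
    (coeffwiseDerivation_mem_span D _ fun f hf m => hs f (Finset.mem_coe.mp hf) m)
  -- `algebraMap k (P ⧸ I) a = mk (C a)` definitionally; the `ℤ`-module structures on `P ⧸ I`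
  -- found along the two routes agree definitionally
  refine ⟨D', fun a => ?_⟩
  exact (hD' (C a)).trans (congrArg (Ideal.Quotient.mk _) (coeffwiseDerivation_C D a))

end Summit.ResolutionOfSingularities.ResolutionOfSingularities.Theorems

end
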